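import Summits.BirchSwinnertonDyer.BirchSwinnertonDyer.Theorems.ByReductionTypeAtTwoSupersingularFlatCoinvChase
import Literature.NumberTheory.EllipticCurves.IwasawaSelmerControlLocalizationProofs
import Literature.NumberTheory.EllipticCurves.SubgroupSelmerProofs
import HarnessLib

/-!
# Local lift at an INFINITE place (LOC∞ of the LIFT assembly): «for archimedean `v`, one easily
# verifies that `𝒫^{(v)}(F) ≅ 𝒫^{(v)}(F_∞)^Γ`» (Greenberg, LNM 1716 p. 107) — the real places split
# completely in a `ℤ_p`-extension, so the layer-`0` and the tower local groups COINCIDE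

Seat `bsd-2adic-ss-1` GEN 12, crux `SupersingularRankZeroAtTwo` (item stmt-BirchSwinnertonDyer-19097, route
`ByReductionTypeAtTwo`, rung K4), line `flat_uniform_two` v1, stub (2) `stub_allFlatData`, conjunct
COUNT♭@2 — part 6 of the series (part 5 `…FlatLiftAssembly`: «LIFT′ on `H¹(K_Σ/K_∞, E[p^∞])`» ⟸
CASSELS + per-place local lifts). This file DISCHARGES the local lift at every infinite place `w`, in
exactly the shape the assembly consumes (hypothesis `hinf` of
`exists_sub_layerToInfty_mem_sharpFlatSelmerInfty_of_cassels_of_localLifts`), for EVERY class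
`t ∈ H¹(K_∞, E[p^∞])` (no invariance hypothesis is even needed): since `Γ_{K_w}` is finite and `ℤ_p` is
torsion-free, `Γ_{K_w} → Γ_K` lands in `Gal(K̄/K_∞)` (tree `ZpExtension.resGal_infinitePlace_mem_kerSubgroup`,
Greenberg p. 86 «If `v` is archimedean, then `v` splits completely in `F_∞/F`, i.e., `F_v = K_η`»), so
the local subgroups `H_{w,0} = (Γ_{K_w} → Γ_K)⁻¹(Γ_K)` and `H_{w,∞} = (Γ_{K_w} → Γ_K)⁻¹(Gal(K̄/K_∞))` of
`Γ_{K_w}` are EQUAL, the local tower restriction `r_w : H¹(H_{w,0}, E(K̄_w)) → H¹(H_{w,∞}, E(K̄_w))` is a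
bijection (`resOfLe` along equal subgroups), and the layer-`0` class `x_w := r_w⁻¹(loc_w t)` does it:
`loc_w(t − h_0 y) = loc_w t − r_w(loc_w y) = loc_w t − r_w x_w = 0` (`localResOverOfEmb_resOfLe`). At
`p = 2` this is where `H¹(ℝ, E[2^∞]) ≅ E(ℝ)/E(ℝ)_con` (order `2` iff `Δ > 0`, p. 106) sits on BOTH
sides of `r_w` — the real place contributes no cokernel (and no kernel), as recorded in GEN 11's
MEMO-COUNTflat-realplace §4/§6.

WHAT IS PROVED (namespace `…Theorems.SSFlatEC`; any number field `K`, prime `p`, `ℤ_p`-extension `κ`,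
infinite place `w`): `exists_localLift_infinitePlace` — for every `t ∈ H¹(K_∞, E[p^∞])` there is a
`p`-power-torsion `x_w ∈ H¹(H_{w,0}, E(K̄_w))` such that every `y ∈ H¹(K, E[p^∞])` (`= H¹(κ⁻¹(ℤ_p),
E[p^∞])`) with `loc_w y = x_w` has `t − h_0 y ∈ localKerOver (ker κ) K_w` — verbatim the `hinf` clause
of the assembly. HONEST FRAMING: a kernel theorem about the tree's objects; nothing about any curve is
asserted; no census cell moves; BSD is not proved by any of this.

References: [GreenbergLNM1716] §3 p. 86, §4 pp. 106–107 (archimedean factors at `p = 2`, «`𝒫^{(v)}(F) ≅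
𝒫^{(v)}(F_∞)^Γ`»); [SerreGaloisCohomology1997] I §2.4.
-/

set_option autoImplicit false
-- the Theorems namespace of this sub repeats the summit name by design (D-0017 nested layout)
set_option linter.dupNamespace false

noncomputable section

open scoped Classical NumberField

open NumberField IsDedekindDomain

universe u

namespace Summit.BirchSwinnertonDyer.BirchSwinnertonDyer.Theorems.SSFlatEC

open Literature.NumberTheory.EllipticCurves Literature.NumberTheory.GaloisRepresentations
  WeierstrassCurve ZpExtension

section Infinite

variable {K : Type u} [Field K] [NumberField K] (W : WeierstrassCurve K) {p : ℕ} [Fact p.Prime]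
  (κ : ZpExtension K p) (w : InfinitePlace K)

omit [NumberField K] in
/-- At an infinite place the local subgroups of `Γ_{K_w}` attached to `Γ_K = κ⁻¹(p⁰ℤ_p)` and to
`Gal(K̄/K_∞) = ker κ` coincide (both are all of `Γ_{K_w}`): `w` splits completely in `K_∞/K`
(`ZpExtension.resGal_infinitePlace_mem_kerSubgroup`). [cite: GreenbergLNM1716, §3 p. 86] -/
theorem localSubgroup_layer_zero_le_ker_infinitePlace :
    localSubgroup (κ.layerSubgroup 0) w.Completion ≤ localSubgroup κ.kerSubgroup w.Completion :=
  fun τ _ ↦ (mem_localSubgroup_iff _ _ τ).mpr (ZpExtension.resGal_infinitePlace_mem_kerSubgroup κ w τ)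

/-- **LOC∞ — the local lift at an infinite place `w`, in the shape consumed by the LIFT assembly.**
For every `t ∈ H¹(K_∞, E[p^∞])` there is a `p`-power-torsion layer-`0` local class
`x_w ∈ H¹(H_{w,0}, E(K̄_w))` (namely `r_w⁻¹(loc_w t)`, `r_w` being a bijection because `w` splits
completely in `K_∞/K`) such that for every `y ∈ H¹(K, E[p^∞])` with `loc_w y = x_w` the class
`t − h_0 y` dies in `H¹(H_{w,∞}, E(K̄_w))`: Greenberg's «for archimedean `v`, one easily verifies that
`𝒫_E^{(v)}(F) ≅ 𝒫_E^{(v)}(F_∞)^Γ`» (at `p = 2` the order-`≤ 2` group `H¹(K_w, E)[2^∞]` sits on both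
sides). [cite: GreenbergLNM1716, §4 p. 107 and p. 106 (p = 2, F_v = ℝ), §3 p. 86] -/
theorem exists_localLift_infinitePlace (t : W.subgroupH1 p κ.kerSubgroup) :
    ∃ xw : discreteH1 (localSubgroup (κ.layerSubgroup 0) w.Completion) (localPoints W w.Completion),
      (∃ k : ℕ, p ^ k • xw = 0) ∧
      ∀ y : W.subgroupH1 p (κ.layerSubgroup 0),
        W.localResOver p (κ.layerSubgroup 0) w.Completion y = xw →
        t - W.layerToInfty κ 0 y ∈ W.localKerOver p κ.kerSubgroup w.Completion := by
  -- the two local subgroups coincide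
  have hle : localSubgroup κ.kerSubgroup w.Completion ≤ localSubgroup (κ.layerSubgroup 0) w.Completion :=
    localSubgroup_ker_le_layer κ w.Completion 0
  have hge := localSubgroup_layer_zero_le_ker_infinitePlace κ w
  -- `r_w` (restriction along `hle`) has the two-sided inverse `s_w` (restriction along `hge`)
  let r := Literature.NumberTheory.EllipticCurves.resOfLe (localPoints W w.Completion) hle
  let s := Literature.NumberTheory.EllipticCurves.resOfLe (localPoints W w.Completion) hge
  have hrs : ∀ z, r (s z) = z := fun z ↦ by
    have e : (Literature.NumberTheory.EllipticCurves.resOfLe (localPoints W w.Completion) hle).comp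
        (Literature.NumberTheory.EllipticCurves.resOfLe (localPoints W w.Completion) hge) =
        AddMonoidHom.id _ := by
      rw [resOfLe_comp_holds (M := localPoints W w.Completion) hle hge]
      exact resOfLe_refl_holds (M := localPoints W w.Completion) _
    exact DFunLike.congr_fun e z
  -- the class `x_w = s(loc_w t)`
  refine ⟨s (W.localResOver p κ.kerSubgroup w.Completion t), ?_, fun y hy ↦ ?_⟩
  · obtain ⟨k, hk⟩ := W.exists_pow_smul_subgroupH1_ker_eq_zero κ t
    exact ⟨k, by rw [← map_nsmul, ← map_nsmul, hk, map_zero, map_zero]⟩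
  · rw [mem_localKerOver_iff, map_sub]
    have hnat := W.localResOverOfEmb_resOfLe p (closureEmb (K := K) w.Completion)
      (κ.kerSubgroup_le_layerSubgroup 0) y
    have hy' : W.localResOverOfEmb p (κ.layerSubgroup 0) (closureEmb (K := K) w.Completion) y =
        s (W.localResOver p κ.kerSubgroup w.Completion t) := hy
    have h0 : W.localResOver p κ.kerSubgroup w.Completion (W.layerToInfty κ 0 y) =
        W.localResOver p κ.kerSubgroup w.Completion t :=
      hnat.trans ((congrArg _ hy').trans (hrs _))
    rw [h0, sub_self]

end Infinite

end Summit.BirchSwinnertonDyer.BirchSwinnertonDyer.Theorems.SSFlatEC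

end
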